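import Summits.ValiantsHypothesis.ValiantsHypothesis.Theorems.KPlusLogSqLawWeakLiftingBridge
import Summits.ValiantsHypothesis.ValiantsHypothesis.Theorems.KPlusLogSqLawTropicalBSmallFormats

/-!
# Route «KPlusLogSqLaw» — crux `Lifting` on BOUNDED-`K` strips: Conjecture B is silent there, and the fixed-`K`
# content of `Lifting` is a degree-matching law (the typed «`K = 4` fork»)

HONEST FRAMING.  Bookkeeping toward the crux `Lifting` (`Summit.ValiantsHypothesis.ValiantsHypothesis.Theses.KPlusLogSqLaw.Lifting`,
stmt-ValiantsHypothesis-19772) of the cell's Conjecture-B route (object-search cell `pub-symmetroid`, D-0041/D-0059); companion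
of `KPlusLogSqLawWeakLiftingBridge` (B ⇔ weak LIFT ∧ TB) and of the seat note HOME/val-sym-lift-p4/GAP-LIFT.md §2.  Everything
here is either a DESCARTES-ZONE theorem (no hypothesis) or an IMPLICATION between OPEN statements of the cell (`TropicalLifting`,
`TropK4Law e`); nothing asserts `Lifting`, `TropicalB`, `KPlusLogSqLaw`, `MatrixDescartes` or anything about `VP ≠ VNP`.

CONTENTS (all proved).
* `realRootLawAt_poly` — the fixed-`K` POLYNOMIAL real row: `RealRootLawAt m K (2·(m+1)^(K−1) − 1)` (Descartes
  `Census.realRootLawAt_descartes` + stars and bars `multichoose_le_succ_pow`); twin of the tropical `tropRootLawAt_poly`.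
* `kPlusLogSqLaw_boundedK` — **B holds on every bounded strip `K ≤ K₀`, for all `m`, with `C = 2K₀`** (no hypothesis): at
  fixed `K` the budget `2^{C(K + log₂² m)}` is quasi-polynomial in `m` and swallows Descartes' `2(m+1)^{K−1}`.  So NO fixed-`K`
  phenomenon (in particular no outcome of the `K = 4` fork) bears on B; B binds only in the window `log₂ m ≪ K ≪ m`.
* `weakLifting_boundedK` — the same for the weak lifting law (slack `2^{C(K+log₂² m)}`), again with no tropical input.
* `realRow_of_lifting_of_tropRow` — the FIXED-`K` CONTENT of `Lifting` as typed: LIFT turns any tropical row bound `B(m)` at `K`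
  into the real row bound `c·(B(m)+1)` with ONE constant `c = 2^{CK}` for all `m`; `realRowFour_of_lifting_of_tropK4Law` — with
  `TropK4Law e`: LIFT ⇒ `∃ c, ∀ m, RealRootLawAt m 4 (c·(m+1)^e)`.
* `not_lifting_of_tropK4Law_of_realGrowth` — **the `K = 4` fork, typed**: if `T(m,4) = O((m+1)^e)` (`TropK4Law e`) while the
  real row `(m,4)` outgrows every `c·(m+1)^e`, then `Lifting` is FALSE as typed (and B is untouched: `kPlusLogSqLaw_boundedK`);
  general-`K` form `not_lifting_of_tropRow_of_realGrowth`.  The cell's open calibration (`TropK4Law 2`?, `ζ(m,4) = Θ(m³)`?) is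
  exactly the hypothesis pair; nothing is claimed about it. [folklore]
-/

-- `Summit.ValiantsHypothesis.ValiantsHypothesis.…` repeats a component by the D-0017 layout
-- (single-conjunct summit), which the `dupNamespace` linter flags; the name is mandated.
set_option linter.dupNamespace false
set_option autoImplicit false

namespace Summit.ValiantsHypothesis.ValiantsHypothesis.Theorems.LacunarySymmetroidMatrixDescartes.TropicalCensus

open Summit.ValiantsHypothesis.ValiantsHypothesis.Theorems.LacunarySymmetroidMatrixDescartes

/-! ## 1. The fixed-`K` polynomial real row and Conjecture B on bounded strips -/

/-- **Fixed-`K` polynomial real row** (Descartes + stars and bars): `ζ(m,K) ≤ 2·(m+1)^(K−1) − 1`. [folklore] -/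
theorem realRootLawAt_poly (m K : ℕ) (hK : 0 < K) : RealRootLawAt m K (2 * (m + 1) ^ (K - 1) - 1) := by
  refine Census.realRootLawAt_mono ?_ (Census.realRootLawAt_descartes m K hK)
  have h : Nat.choose (m + K - 1) m ≤ (m + 1) ^ (K - 1) := by
    rw [show m + K - 1 = K + m - 1 by omega, ← Nat.multichoose_eq]
    exact multichoose_le_succ_pow K m
  omega

/-- the arithmetic of the bounded strip: `2·(m+1)^(K−1) − 1 ≤ 2^(2K₀·(K + log₂² m))` for `1 ≤ K ≤ K₀`. [folklore] -/
theorem two_mul_succ_pow_le_budget {K₀ K : ℕ} (m : ℕ) (hK : 0 < K) (hKK₀ : K ≤ K₀) :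
    2 * (m + 1) ^ (K - 1) - 1 ≤ 2 ^ (2 * K₀ * (K + Nat.log 2 m ^ 2)) := by
  have h1 : (m + 1) ^ (K - 1) ≤ (2 ^ (Nat.log 2 m + 1)) ^ (K - 1) := Nat.pow_le_pow_left (Nat.lt_pow_succ_log_self one_lt_two m) _
  rw [← pow_mul] at h1
  have h2 : 2 * (m + 1) ^ (K - 1) ≤ 2 ^ ((Nat.log 2 m + 1) * (K - 1) + 1) := by
    rw [pow_succ]; omega
  have h3 : (Nat.log 2 m + 1) * (K - 1) + 1 ≤ 2 * K₀ * (K + Nat.log 2 m ^ 2) := by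
    have hL : Nat.log 2 m ≤ Nat.log 2 m ^ 2 + 1 := by nlinarith [Nat.zero_le (Nat.log 2 m)]
    have hK1 : K - 1 ≤ K₀ - 1 := by omega
    have hK₀ : 1 ≤ K₀ := by omega
    calc (Nat.log 2 m + 1) * (K - 1) + 1 ≤ (Nat.log 2 m + 1) * (K₀ - 1) + 1 := by
            have := Nat.mul_le_mul_left (Nat.log 2 m + 1) hK1; omega
      _ ≤ (Nat.log 2 m ^ 2 + 2) * (K₀ - 1) + 1 := by
            have := Nat.mul_le_mul_right (K₀ - 1) (show Nat.log 2 m + 1 ≤ Nat.log 2 m ^ 2 + 2 by omega); omega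
      _ ≤ 2 * K₀ * (K + Nat.log 2 m ^ 2) := by
            have e1 : (Nat.log 2 m ^ 2 + 2) * (K₀ - 1) + (Nat.log 2 m ^ 2 + 2) = (Nat.log 2 m ^ 2 + 2) * K₀ := by
              rw [← Nat.mul_succ, show Nat.succ (K₀ - 1) = K₀ by omega]
            have e2 : 2 * K₀ * (K + Nat.log 2 m ^ 2) = 2 * K₀ * K + 2 * (Nat.log 2 m ^ 2 * K₀) := by ring
            have e3 : (Nat.log 2 m ^ 2 + 2) * K₀ = Nat.log 2 m ^ 2 * K₀ + 2 * K₀ := by ring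
            have e4 : 2 * K₀ ≤ 2 * K₀ * K := Nat.le_mul_of_pos_right _ hK
            omega
  exact (Nat.sub_le _ _).trans (h2.trans (Nat.pow_le_pow_right (by norm_num) h3))

/-- **Conjecture B holds on every bounded-`K` strip** (no hypothesis): for every `K₀` there is `C` (`= 2K₀`) with
`RealRootLawAt m K (2^(C (K + log₂² m)))` for all `m` and all `K ≤ K₀`.  Fixed-`K` phenomena never bear on B. [folklore] -/
theorem kPlusLogSqLaw_boundedK (K₀ : ℕ) :
    ∃ C : ℕ, ∀ m K : ℕ, K ≤ K₀ → RealRootLawAt m K (2 ^ (C * (K + Nat.log 2 m ^ 2))) := by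
  refine ⟨2 * K₀, fun m K hKK₀ => ?_⟩
  rcases Nat.eq_zero_or_pos K with hK | hK
  · subst hK; exact realRootLawAt_zero m _
  · exact Census.realRootLawAt_mono (two_mul_succ_pow_le_budget m hK hKK₀) (realRootLawAt_poly m K hK)

/-- **The weak lifting law holds on every bounded-`K` strip**, with no tropical input. [folklore] -/
theorem weakLifting_boundedK (K₀ : ℕ) :
    ∃ C : ℕ, ∀ m K n : ℕ, K ≤ K₀ → TropRootLawAt m K n →
      RealRootLawAt m K (2 ^ (C * (K + Nat.log 2 m ^ 2)) * (n + 1)) := by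
  obtain ⟨C, hC⟩ := kPlusLogSqLaw_boundedK K₀
  exact ⟨C, fun m K n hKK₀ _ => Census.realRootLawAt_mono (Nat.le_mul_of_pos_right _ (Nat.succ_pos n)) (hC m K hKK₀)⟩

/-! ## 2. The fixed-`K` content of `Lifting` as typed: a degree-matching law; the `K = 4` fork -/

/-- **Fixed-`K` content of LIFT**: a tropical row bound `B(m)` at `K` becomes the real row bound `c·(B(m)+1)` with ONE constant
`c` for all `m`. [folklore] -/
theorem realRow_of_lifting_of_tropRow (hL : TropicalLifting) (K : ℕ) (B : ℕ → ℕ) (hT : ∀ m, TropRootLawAt m K (B m)) :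
    ∃ c : ℕ, ∀ m, RealRootLawAt m K (c * (B m + 1)) := by
  obtain ⟨C, hC⟩ := hL
  exact ⟨2 ^ (C * K), fun m => hC m K (B m) (hT m)⟩

/-- **LIFT ∧ `TropK4Law e` ⇒ the real row `(m,4)` is `O((m+1)^e)`** with one constant. [folklore] -/
theorem realRowFour_of_lifting_of_tropK4Law (hL : TropicalLifting) {e : ℕ} (h4 : TropK4Law e) :
    ∃ c : ℕ, ∀ m, RealRootLawAt m 4 (c * (m + 1) ^ e) := by
  obtain ⟨C', hC'⟩ := h4
  obtain ⟨c, hc⟩ := realRow_of_lifting_of_tropRow hL 4 (fun m => C' * (m + 1) ^ e) hC'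
  refine ⟨c * (C' + 1), fun m => Census.realRootLawAt_mono ?_ (hc m)⟩
  have h1 : 1 ≤ (m + 1) ^ e := Nat.one_le_pow _ _ (Nat.succ_pos m)
  calc c * (C' * (m + 1) ^ e + 1) ≤ c * (C' * (m + 1) ^ e + (m + 1) ^ e) := Nat.mul_le_mul_left _ (by omega)
    _ = c * (C' + 1) * (m + 1) ^ e := by ring

/-- **The fork, general `K`, typed**: a tropical row law `B(m)` at `K` together with a real family outgrowing every `c·(B(m)+1)`
refutes `Lifting` as typed. [folklore] -/
theorem not_lifting_of_tropRow_of_realGrowth (K : ℕ) (B : ℕ → ℕ) (hT : ∀ m, TropRootLawAt m K (B m))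
    (hreal : ∀ c : ℕ, ∃ m, ¬ RealRootLawAt m K (c * (B m + 1))) : ¬ TropicalLifting := by
  intro hL
  obtain ⟨c, hc⟩ := realRow_of_lifting_of_tropRow hL K B hT
  obtain ⟨m, hm⟩ := hreal c
  exact hm (hc m)

/-- **The `K = 4` fork, typed**: `TropK4Law e` (tropical row `(m,4)` is `O((m+1)^e)`) plus a real symmetric `(m,4)` family with more
than `c·(m+1)^e` distinct real zeros for every `c` refutes `Lifting` AS TYPED — while Conjecture B is untouched
(`kPlusLogSqLaw_boundedK`).  With `e = 2` this is the cell's open calibration «quadratic tropical / cubic real at `K = 4`»;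
nothing is claimed about either hypothesis. [folklore] -/
theorem not_lifting_of_tropK4Law_of_realGrowth {e : ℕ} (h4 : TropK4Law e)
    (hreal : ∀ c : ℕ, ∃ m, ¬ RealRootLawAt m 4 (c * (m + 1) ^ e)) : ¬ TropicalLifting := by
  intro hL
  obtain ⟨c, hc⟩ := realRowFour_of_lifting_of_tropK4Law hL h4
  obtain ⟨m, hm⟩ := hreal c
  exact hm (hc m)

end Summit.ValiantsHypothesis.ValiantsHypothesis.Theorems.LacunarySymmetroidMatrixDescartes.TropicalCensus
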